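import Summits.MatrixMultiplication.MatrixMultiplication.Theses.SnSubsetDichotomy

/-!
# `ThresholdSubsetTriples` (crux stmt-MatrixMultiplication-10882, route `SnSubsetDichotomy`) —
# negative-side support VI: the `e^{O(√n)} ≪ √(n!)` bookkeeping and the void symmetric ansatz `S = T`
# (refuter cdisprove gen 2)

Definition-free copy of §6 of the crux workfile `Cruxes/ThresholdSubsetTriples/Disproof.lean` (v5).
Sorry-free content: `exp_sqrt_le_sqrt_factorial` (`e^{c√n} ≤ √(n!)` for all large `n`),
`factorial_le_threshold` (`n! ≤ (n!)^{3/2}·e^{-c√n}` eventually: a triple of volume `≤ n!` — e.g. one set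
of size `≤ 1` — is never a threshold witness for large `n`), `quot_eq_one_of_tpp` (the pair rule
`Q(S) ∩ Q(T) = {1}` of a TPP triple, any group), `card_le_one_of_tpp_self` (`TPP(S, S, U) ⇒ |S| ≤ 1`), and
`not_thresholdTwoEqualSets`: `X` restricted to triples with `S = T` is FALSE at every scale — the `g = 1`
case of every translate / triality ansatz `T = gS` (lines `SketchIdeator2`, `triality-uniquely-cubing-translate`).

Sources: Cohn–Umans 2003 Def. 2.1 (tree `TripleProductProperty`); Blasiak–Church–Cohn–Grochow–Umans 2017
(arXiv:1712.02302) §5 (threshold calibration); folklore.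
-/

noncomputable section

set_option linter.dupNamespace false
set_option autoImplicit false

open scoped BigOperators Pointwise

namespace Summit.MatrixMultiplication.MatrixMultiplication.Theorems.ThresholdSubsetTriples.Negative

open Summit.MatrixMultiplication.MatrixMultiplication.Theses.SnSubsetDichotomy
open Literature.Combinatorics.Additive

/-! ## §6 The `e^{O(√n)} ≪ √(n!)` bookkeeping and the degenerate symmetric ansätze -/

/-- **Asymptotic bookkeeping.** `e^{c√n} ≤ √(n!)` for all large `n` (crudely: `n! ≥ k^k`, `k = ⌊n/2⌋`,
and `c√n ≤ (n-1)/4` once `√n ≥ 4c+1`).  Used to discharge every "`|S| ≤ 1` cannot beat the threshold"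
step below. -/
theorem exp_sqrt_le_sqrt_factorial {c : ℝ} (hc : 0 ≤ c) :
    ∃ n₀ : ℕ, ∀ n : ℕ, n₀ ≤ n → Real.exp (c * Real.sqrt n) ≤ Real.sqrt (n.factorial : ℝ) := by
  refine ⟨max 6 ⌈(4 * c + 1) ^ 2⌉₊, fun n hn => ?_⟩
  have hn6 : 6 ≤ n := (le_max_left _ _).trans hn
  have hnc : (4 * c + 1) ^ 2 ≤ (n : ℝ) :=
    (Nat.le_ceil _).trans (by exact_mod_cast (le_max_right _ _).trans hn)
  have hs : 4 * c + 1 ≤ Real.sqrt n := by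
    rw [show (4 * c + 1) = Real.sqrt ((4 * c + 1) ^ 2) from (Real.sqrt_sq (by linarith)).symm]
    exact Real.sqrt_le_sqrt hnc
  have hs1 : 1 ≤ Real.sqrt n := by linarith
  have hss : Real.sqrt n * Real.sqrt n = n := Real.mul_self_sqrt (Nat.cast_nonneg n)
  have h1 : 4 * c * Real.sqrt n + 1 ≤ n := by nlinarith [hs, hs1, hss]
  set k := n / 2 with hk
  have hk3 : 3 ≤ k := by omega
  have h2k : 2 * k ≤ n := by omega
  have hn2k : n ≤ 2 * k + 1 := by omega
  have hfac : k ^ k ≤ n.factorial := by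
    have h := Nat.factorial_mul_pow_sub_le_factorial (show k ≤ 2 * k by omega)
    rw [show 2 * k - k = k by omega] at h
    calc k ^ k ≤ k.factorial * k ^ k := Nat.le_mul_of_pos_left _ (Nat.factorial_pos k)
      _ ≤ (2 * k).factorial := h
      _ ≤ n.factorial := Nat.factorial_le h2k
  have hk0 : (0 : ℝ) < k := by exact_mod_cast (by omega : 0 < k)
  have hlogk : 1 ≤ Real.log k := by
    rw [Real.le_log_iff_exp_le hk0]
    have he : Real.exp 1 < 3 := lt_trans Real.exp_one_lt_d9 (by norm_num)
    have h3k : (3 : ℝ) ≤ k := by exact_mod_cast hk3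
    linarith
  have hlogfac : (k : ℝ) * Real.log k ≤ Real.log (n.factorial : ℝ) := by
    rw [← Real.log_pow]
    refine Real.log_le_log (by positivity) ?_
    exact_mod_cast hfac
  have hklow : ((n : ℝ) - 1) / 2 ≤ k := by
    have : (n : ℝ) ≤ 2 * k + 1 := by exact_mod_cast hn2k
    linarith
  have hmain : c * Real.sqrt n ≤ Real.log (n.factorial : ℝ) / 2 := by
    have hk1 : (k : ℝ) ≤ k * Real.log k := by nlinarith [hlogk, hk0]
    linarith [h1, hklow, hk1, hlogfac]
  have hF0 : (0 : ℝ) < (n.factorial : ℝ) := by exact_mod_cast Nat.factorial_pos n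
  calc Real.exp (c * Real.sqrt n) ≤ Real.exp (Real.log (n.factorial : ℝ) / 2) :=
        Real.exp_le_exp.2 hmain
    _ = Real.sqrt (n.factorial : ℝ) := by
        rw [Real.sqrt_eq_rpow, Real.rpow_def_of_pos hF0]
        congr 1
        ring

/-- Consequence: at scale `c > 0` the threshold `(n!)^{3/2}·e^{-c√n}` eventually exceeds `n!`, so a
triple of volume `≤ n!` (e.g. one set of size `≤ 1`) is never a witness for large `n`. -/
theorem factorial_le_threshold {c : ℝ} (hc : 0 ≤ c) :
    ∃ n₀ : ℕ, ∀ n : ℕ, n₀ ≤ n →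
      (n.factorial : ℝ) ≤ (n.factorial : ℝ) ^ ((3 : ℝ) / 2) * Real.exp (-(c * Real.sqrt n)) := by
  obtain ⟨n₀, h⟩ := exp_sqrt_le_sqrt_factorial hc
  refine ⟨n₀, fun n hn => ?_⟩
  have hF : (0 : ℝ) < (n.factorial : ℝ) := by exact_mod_cast Nat.factorial_pos n
  set F : ℝ := (n.factorial : ℝ) with hFdef
  have hrpow : F ^ ((3 : ℝ) / 2) = F * Real.sqrt F := by
    rw [Real.rpow_div_two_eq_sqrt _ hF.le, Real.rpow_ofNat, pow_succ, Real.sq_sqrt hF.le]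
  have he : Real.exp (c * Real.sqrt n) * Real.exp (-(c * Real.sqrt n)) = 1 := by
    rw [← Real.exp_add, add_neg_cancel, Real.exp_zero]
  have h1 : F * 1 ≤ F * (Real.sqrt F * Real.exp (-(c * Real.sqrt n))) := by
    refine mul_le_mul_of_nonneg_left ?_ hF.le
    calc (1 : ℝ) = Real.exp (c * Real.sqrt n) * Real.exp (-(c * Real.sqrt n)) := he.symm
      _ ≤ Real.sqrt F * Real.exp (-(c * Real.sqrt n)) :=
          mul_le_mul_of_nonneg_right (h n hn) (Real.exp_pos _).le
  calc F = F * 1 := (mul_one F).symm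
    _ ≤ F * (Real.sqrt F * Real.exp (-(c * Real.sqrt n))) := h1
    _ = F ^ ((3 : ℝ) / 2) * Real.exp (-(c * Real.sqrt n)) := by rw [hrpow, mul_assoc]

/-- **Pair rule (T4 of the lead's catalogue, any group).** In a TPP triple with `U` non-empty the quotient
sets `Q(S) = S·S⁻¹` and `Q(T)` meet only in `1`. -/
theorem quot_eq_one_of_tpp {G : Type*} [Group G] {S T U : Finset G}
    (h : TripleProductProperty S T U) (hU : U.Nonempty) {s s' t t' : G} (hs : s ∈ S) (hs' : s' ∈ S)
    (ht : t ∈ T) (ht' : t' ∈ T) (hq : s * s'⁻¹ = t * t'⁻¹) : s = s' ∧ t = t' := by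
  obtain ⟨u, hu⟩ := hU
  have key := h s hs s' hs' t' ht' t ht u hu u hu (by
    rw [hq]; group)
  exact ⟨key.1, key.2.1.symm⟩

/-- **Two equal sets are void.** `TPP(S, S, U)` with `U ≠ ∅` forces `|S| ≤ 1` (`Q(S) ∩ Q(S) = {1}`). -/
theorem card_le_one_of_tpp_self {G : Type*} [Group G] {S U : Finset G}
    (h : TripleProductProperty S S U) (hU : U.Nonempty) : S.card ≤ 1 := by
  rw [Finset.card_le_one]
  intro s hs s' hs'
  exact (quot_eq_one_of_tpp h hU hs hs' hs hs' rfl).1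

/-- **REFUTED degenerate ansatz** — `X` restricted to triples whose first two sets coincide (the `g = 1`
case of every translate / triality ansatz `T = gS`): with two equal sets the threshold is unreachable at
EVERY scale (`|S| ≤ 1`, so the volume is `≤ |U| ≤ n! ≤ (n!)^{3/2}e^{-c√n}` for large `n`). -/
theorem not_thresholdTwoEqualSets :
    ¬ (∀ c : ℝ, 0 < c → ∀ n₀ : ℕ, ∃ n ≥ n₀, ∃ S U : Finset (Equiv.Perm (Fin n)),
      TripleProductProperty S S U ∧
        (n.factorial : ℝ) ^ ((3 : ℝ) / 2) * Real.exp (-(c * Real.sqrt (n : ℝ))) <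
          ((S.card * S.card * U.card : ℕ) : ℝ)) := by
  intro h
  obtain ⟨n₀, hn₀⟩ := factorial_le_threshold (show (0 : ℝ) ≤ 1 by norm_num)
  obtain ⟨n, hn, S, U, hTPP, hlt⟩ := h 1 one_pos n₀
  have hprod : 0 < S.card * S.card * U.card := by
    have h0 : (0 : ℝ) < ((S.card * S.card * U.card : ℕ) : ℝ) := lt_of_le_of_lt (by positivity) hlt
    exact_mod_cast h0
  have hU : U.Nonempty := Finset.card_pos.1 (Nat.pos_of_ne_zero fun h0 => by simp [h0] at hprod)
  have hS1 : S.card ≤ 1 := card_le_one_of_tpp_self hTPP hU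
  have hvol : S.card * S.card * U.card ≤ n.factorial := by
    have hUc : U.card ≤ n.factorial := by
      calc U.card ≤ (Finset.univ : Finset (Equiv.Perm (Fin n))).card := Finset.card_le_univ U
        _ = n.factorial := by rw [Finset.card_univ, Fintype.card_perm, Fintype.card_fin]
    calc S.card * S.card * U.card ≤ 1 * 1 * U.card :=
          Nat.mul_le_mul (Nat.mul_le_mul hS1 hS1) le_rfl
      _ = U.card := by ring
      _ ≤ n.factorial := hUc
  have hvol' : ((S.card * S.card * U.card : ℕ) : ℝ) ≤ (n.factorial : ℝ) := by exact_mod_cast hvol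
  have h1 := hn₀ n hn
  linarith


end Summit.MatrixMultiplication.MatrixMultiplication.Theorems.ThresholdSubsetTriples.Negative

end
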